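import Mathlib
import Summits.Ventures.PercRepro2.HCov
import Summits.Ventures.PercRepro2.ContractDefs
import Summits.Ventures.PercRepro2.RECMReduction
import Summits.Ventures.PercRepro2.GcTransport
import Summits.Ventures.PercRepro2.GcTransportMarks
import Summits.Ventures.PercRepro2.GcSeries
import Summits.Ventures.PercRepro2.GcParallel

/-!
# The weighted reduction rules of the covariance form at ANY vertex (blind cell PercRepro2,
typer-1 g52; the rules of GcSeries.lean / GcParallel.lean freed of the root)

`GcSeries.lean` (p1 g11) removes an unmarked leaf and an unmarked degree-two vertex hanging at a
ROOT edge `e = {a₁, y}`. Its connectivity lemmas `conn_leaf_iff` / `conn_series_iff` never use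
that `a₁` is a mark, so the same rules hold at every attachment vertex `x ≠ y`:

* **`Gc_leaf_at`**: an unmarked `y` whose only non-loop edge is `e = {x, y}` is invisible —
  `Gc p ends = Gc p (ends[e ↦ loop at x])`;
* **`Gc_series_at`**: an unmarked `y` with exactly the two non-loop edges `e = {x, y}`,
  `f = {y, w}` is a series cell — `Gc p ends = Gc p[f ↦ p_e p_f][e ↦ 0] (G/e)` with `G/e` the
  contraction of `{x, y}` onto `x` (`contractRootEdge ends x y`; `f` becomes `{x, w}`);
* **`Gc_eq_of_agree_nonLoop`** / **`Gc_update_loop`**: loops are invisible — two incidence maps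
  that agree on every edge which is a non-loop for either of them have the same `Gc`, so a loop
  may be moved to any vertex;
* **`nonLoopDeg`** (the number of non-loop edges at a vertex) with the two extraction lemmas
  `leaf_of_nonLoopDeg_one` / `series_of_nonLoopDeg_two`, `nonLoopCard_le_of_agree`, and the
  admissibility of the series and parallel weights (`isProbVec_series`, `isProbVec_parallel`).

These are the rules of the weighted reduced-class theorem (`GcSkelReduction.lean`): every unmarked
vertex of non-loop degree one or two, every loop and every parallel pair is removed by an exact
identity of `Gc`, lowering `nonLoopCard`.
-/

namespace Summit.Ventures.PercRepro2

open CovForm Contract RECM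

namespace WRed

/-! ## Loops are invisible -/

section Loops

variable {V : Type*} {E : Type*}

/-- Two incidence maps that agree on every edge which is a non-loop for either of them have the
same open graph in every configuration (loops never carry adjacency). -/
lemma openGraph_eq_of_agree_nonLoop {ends ends' : E → Sym2 V}
    (h : ∀ g, ¬ (ends g).IsDiag → ends' g = ends g)
    (h' : ∀ g, ¬ (ends' g).IsDiag → ends' g = ends g) (ω : Config E) :
    openGraph ends ω = openGraph ends' ω := by
  ext u v
  rw [openGraph_adj, openGraph_adj]
  constructor
  · rintro ⟨huv, g, hgo, hge⟩
    refine ⟨huv, g, hgo, ?_⟩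
    rw [h g (by rw [hge, Sym2.mk_isDiag_iff]; exact huv), hge]
  · rintro ⟨huv, g, hgo, hge⟩
    refine ⟨huv, g, hgo, ?_⟩
    rw [← h' g (by rw [hge, Sym2.mk_isDiag_iff]; exact huv), hge]

/-- Connectivity only sees the non-loop edges. -/
lemma conn_iff_of_agree_nonLoop {ends ends' : E → Sym2 V}
    (h : ∀ g, ¬ (ends g).IsDiag → ends' g = ends g)
    (h' : ∀ g, ¬ (ends' g).IsDiag → ends' g = ends g) (ω : Config E) (x z : V) :
    Conn ends ω x z ↔ Conn ends' ω x z := by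
  unfold Conn
  rw [openGraph_eq_of_agree_nonLoop h h' ω]

variable [Fintype E] [DecidableEq E] {R : Type*} [Field R]

/-- **Loops are invisible to the covariance form**: two incidence maps that agree on every edge
which is a non-loop for either of them have the same `Gc`. -/
theorem Gc_eq_of_agree_nonLoop (p : E → R) {ends ends' : E → Sym2 V}
    (h : ∀ g, ¬ (ends g).IsDiag → ends' g = ends g)
    (h' : ∀ g, ¬ (ends' g).IsDiag → ends' g = ends g) (o a₁ a₂ a₃ b : V) :
    Gc p ends o a₁ a₂ a₃ b = Gc p ends' o a₁ a₂ a₃ b :=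
  Gc_transport_marks (Ψ := id) (φ := id) (fun A => by simp) o a₁ a₂ a₃ b
    (fun ω _ _ _ _ => conn_iff_of_agree_nonLoop h h' ω _ _)

/-- A loop may be moved to any vertex without changing `Gc`. -/
theorem Gc_update_loop (p : E → R) {ends : E → Sym2 V} {g : E} (hg : (ends g).IsDiag) (z : V)
    (o a₁ a₂ a₃ b : V) :
    Gc p ends o a₁ a₂ a₃ b = Gc p (Function.update ends g s(z, z)) o a₁ a₂ a₃ b := by
  apply Gc_eq_of_agree_nonLoop
  · intro g' hg'
    have hne : g' ≠ g := fun h => hg' (by rw [h]; exact hg)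
    rw [Function.update_of_ne hne]
  · intro g' hg'
    have hne : g' ≠ g := by
      intro h
      subst h
      rw [Function.update_self, Sym2.mk_isDiag_iff] at hg'
      exact hg' rfl
    rw [Function.update_of_ne hne]

end Loops

/-! ## The non-loop degree -/

section Degree

variable {V : Type*} {E : Type*} [Fintype E] [DecidableEq E] [DecidableEq V]

/-- The non-loop edges at `y`. -/
def edgesAt (ends : E → Sym2 V) (y : V) : Finset E :=
  Finset.univ.filter fun g => y ∈ ends g ∧ ¬ (ends g).IsDiag

omit [DecidableEq E] in
/-- Membership in `edgesAt`. -/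
lemma mem_edgesAt {ends : E → Sym2 V} {y : V} {g : E} :
    g ∈ edgesAt ends y ↔ y ∈ ends g ∧ ¬ (ends g).IsDiag := by
  simp [edgesAt]

/-- The **non-loop degree** of `y`: the number of non-loop edges at `y` (with multiplicity). -/
def nonLoopDeg (ends : E → Sym2 V) (y : V) : ℕ := (edgesAt ends y).card

omit [DecidableEq E] in
/-- **Non-loop degree one = a leaf**: one non-loop edge `e = {x, y}` with `x ≠ y`, every other
edge at `y` a loop. -/
lemma leaf_of_nonLoopDeg_one {ends : E → Sym2 V} {y : V} (h : nonLoopDeg ends y = 1) :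
    ∃ (e : E) (x : V), ends e = s(x, y) ∧ x ≠ y ∧
      ∀ g, g ≠ e → y ∈ ends g → (ends g).IsDiag := by
  obtain ⟨e, he⟩ := Finset.card_eq_one.mp h
  have hem : e ∈ edgesAt ends y := by rw [he]; exact Finset.mem_singleton_self e
  obtain ⟨hye, hed⟩ := mem_edgesAt.mp hem
  obtain ⟨x, hx⟩ := Sym2.mem_iff_exists.mp hye
  refine ⟨e, x, by rw [hx, Sym2.eq_swap], ?_, ?_⟩
  · intro hxy
    rw [hx, Sym2.mk_isDiag_iff] at hed
    exact hed hxy.symm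
  · intro g hge hyg
    by_contra hd
    have : g ∈ edgesAt ends y := mem_edgesAt.mpr ⟨hyg, hd⟩
    rw [he, Finset.mem_singleton] at this
    exact hge this

/-- **Non-loop degree two = a series vertex**: exactly the two non-loop edges `e = {x, y}` and
`f = {y, w}` (`x = w` allowed), every other edge at `y` a loop. -/
lemma series_of_nonLoopDeg_two {ends : E → Sym2 V} {y : V} (h : nonLoopDeg ends y = 2) :
    ∃ (e f : E) (x w : V), e ≠ f ∧ ends e = s(x, y) ∧ ends f = s(y, w) ∧ x ≠ y ∧ y ≠ w ∧
      ∀ g, g ≠ e → g ≠ f → y ∈ ends g → (ends g).IsDiag := by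
  obtain ⟨e, f, hef, hs⟩ := Finset.card_eq_two.mp h
  have hem : e ∈ edgesAt ends y := by rw [hs]; exact Finset.mem_insert_self e {f}
  have hfm : f ∈ edgesAt ends y := by
    rw [hs]; exact Finset.mem_insert_of_mem (Finset.mem_singleton_self f)
  obtain ⟨hye, hed⟩ := mem_edgesAt.mp hem
  obtain ⟨hyf, hfd⟩ := mem_edgesAt.mp hfm
  obtain ⟨x, hx⟩ := Sym2.mem_iff_exists.mp hye
  obtain ⟨w, hw⟩ := Sym2.mem_iff_exists.mp hyf
  refine ⟨e, f, x, w, hef, by rw [hx, Sym2.eq_swap], hw, ?_, ?_, ?_⟩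
  · intro hxy
    rw [hx, Sym2.mk_isDiag_iff] at hed
    exact hed hxy.symm
  · intro hyw
    rw [hw, Sym2.mk_isDiag_iff] at hfd
    exact hfd hyw
  · intro g hge hgf hyg
    by_contra hd
    have : g ∈ edgesAt ends y := mem_edgesAt.mpr ⟨hyg, hd⟩
    rw [hs, Finset.mem_insert, Finset.mem_singleton] at this
    rcases this with h | h
    · exact hge h
    · exact hgf h

omit [DecidableEq E] in
/-- Turning edges into loops does not raise the number of non-loop edges. -/
lemma nonLoopCard_le_of_agree {ends ends' : E → Sym2 V}
    (h' : ∀ g, ¬ (ends' g).IsDiag → ends' g = ends g) :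
    nonLoopCard ends' ≤ nonLoopCard ends := by
  unfold nonLoopCard
  apply Finset.card_le_card
  intro g hg
  simp only [Finset.mem_filter, Finset.mem_univ, true_and] at hg ⊢
  intro hd
  exact hg (by rw [h' g hg]; exact hd)

end Degree

/-! ## The leaf and series rules at any vertex -/

section Rules

variable {V : Type*} {E : Type*} [Fintype E] [DecidableEq E] [DecidableEq V] {R : Type*}
  [Field R]

omit [DecidableEq V] in
/-- **The leaf rule at any vertex**: an unmarked `y` whose only non-loop edge is `e = {x, y}` is
invisible — `Gc` of `G` is `Gc` of `G` with `e` re-routed to a loop at `x` (same weights). -/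
theorem Gc_leaf_at (p : E → R) {ends : E → Sym2 V} {e : E} {o a₁ a₂ a₃ b x y : V}
    (hg : ends e = s(x, y)) (hxy : x ≠ y) (hy : Unmarked o a₁ a₂ a₃ b y)
    (hleaf : ∀ g, g ≠ e → y ∈ ends g → (ends g).IsDiag) :
    Gc p ends o a₁ a₂ a₃ b = Gc p (Function.update ends e s(x, x)) o a₁ a₂ a₃ b :=
  Gc_transport_marks (Ψ := id) (φ := id) (fun A => by simp) o a₁ a₂ a₃ b
    (fun ω _ hx _ hz => conn_leaf_iff hg hxy hleaf ω (ne_of_mem_marks hy hx)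
      (ne_of_mem_marks hy hz))

/-- **The series rule at any vertex**: if the unmarked `y` has exactly the two non-loop edges
`e = {x, y}` and `f = {y, w}`, then `Gc` of `G` is `Gc` of `G/e` (the contraction of `{x, y}` onto
`x`, where `f` has become `{x, w}` and `e` a loop) with the weights `p[f ↦ p_e · p_f][e ↦ 0]`. -/
theorem Gc_series_at (p : E → R) {ends : E → Sym2 V} {e f : E} {o a₁ a₂ a₃ b x y w : V}
    (hg : ends e = s(x, y)) (hf : ends f = s(y, w)) (hef : e ≠ f) (hxy : x ≠ y) (hyw : y ≠ w)
    (hy : Unmarked o a₁ a₂ a₃ b y) (hdeg : ∀ g, g ≠ e → g ≠ f → y ∈ ends g → (ends g).IsDiag) :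
    Gc p ends o a₁ a₂ a₃ b =
      Gc (Function.update (Function.update p f (p e * p f)) e 0) (contractRootEdge ends x y)
        o a₁ a₂ a₃ b :=
  (Gc_transport_marks (φ := id) (prob_series_pushforward p hef) o a₁ a₂ a₃ b
    (fun ω _ hx' _ hz => conn_series_iff hg hf hef hxy hyw hdeg ω (ne_of_mem_marks hy hx')
      (ne_of_mem_marks hy hz))).symm

end Rules

/-! ## Admissibility of the reduced weights -/

section Weights

variable {E : Type*} [DecidableEq E] {R : Type*} [Field R] [LinearOrder R] [IsStrictOrderedRing R]

/-- The series weights `p[f ↦ p_e · p_f][e ↦ 0]` are admissible. -/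
lemma isProbVec_series {p : E → R} (hp : IsProbVec p) (e f : E) :
    IsProbVec (Function.update (Function.update p f (p e * p f)) e 0) :=
  (hp.update f (mul_nonneg (hp.nonneg e) (hp.nonneg f))
    (mul_le_one₀ (hp.le_one e) (hp.nonneg f) (hp.le_one f))).update e le_rfl zero_le_one

/-- The parallel weights `p[g₁ ↦ p_{g₁} + p_{g₂} − p_{g₁} p_{g₂}][g₂ ↦ 0]` are admissible. -/
lemma isProbVec_parallel {p : E → R} (hp : IsProbVec p) (g₁ g₂ : E) :
    IsProbVec (Function.update (Function.update p g₁ (p g₁ + p g₂ - p g₁ * p g₂)) g₂ 0) := by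
  have hs1 := hp.nonneg g₁
  have hs2 := hp.nonneg g₂
  have hs1' := hp.le_one g₁
  have hs2' := hp.le_one g₂
  exact (hp.update g₁ (by nlinarith) (by nlinarith)).update g₂ le_rfl zero_le_one

end Weights

end WRed

end Summit.Ventures.PercRepro2
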